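import Literature.MathematicalPhysics.QuantumLattice.DWaveSourceEnergyDensity
import Literature.MathematicalPhysics.QuantumLattice.TorusGroundEnergyDensityLimit
import Literature.MathematicalPhysics.QuantumLattice.DWaveSourceWindowCertificate
import Literature.MathematicalPhysics.QuantumLattice.DWaveSourceProofs
import HarnessLib

/-!
# The thermodynamic-limit ground-state energy density `e_src(U, μ, h)` of the `d`-wave pair-sourced
# (pinning-field) Hubbard torus EXISTS: variational characterisation and certified windows

Topic `Literature/MathematicalPhysics/QuantumLattice` (family `hubbard`). Written for the pinning-field
programme of the Hubbard cuprate cell (`hubbard-cq`, LADDER row PC-a): the pair-sourced grand-canonical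
torus `A_L = H_L(1,U) − μN_L − h(Δ_d + Δ_d†)` (`dWaveSourceTorus L U μ h`, Koma–Tasaki 1994 §1) is
certified through two-sided windows on its ground-state energy per site at several source strengths
`h`; the transport / Hellmann–Feynman nodes
(`Summit.Ventures.CertifiedManyBodySolver.Observables.SourcedOrderParameterFloor` §3) consume the
LIMIT of `E₀(A_L)/L²`, which the tree did not have (the sourced model breaks particle-number
conservation, so the canonical tiling route `HubbardNNNHoppingThermodynamicLimit` does not apply).

## Contents

* §1 hermiticity of the local energy-density observable `E^src = dWaveSourceEnergyObs U μ h`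
  (`DWaveSourceEnergyDensity.lean`) and the PERIODISATION IDENTITY `Σ_v T_v Γ(E^src) T_v⁻¹ = A_L`
  (`L ≥ 3`; the tree's `sum_conj_fockTranslate_pairSourceObjective` in `relabel` form).
* §2 `tendsto_dWaveSourceEnergyDensity` — THE LIMIT `e_src = dWaveSourceEnergyDensity U μ h` of
  `E₀(A_{L+1})/(L+1)²` EXISTS (instance of the model-free theorem
  `exists_tendsto_groundEnergy_div_pow`: weak-⋆ compactness of averaged ground states + box-state
  upper bound), for ALL real `U, μ, h`.
* §3 the VARIATIONAL CHARACTERISATION: `e_src ≤ Re ω(E^src)` for every translation-invariant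
  infinite-volume state `ω` (`dWaveSourceEnergyDensity_le_re_expect`), with equality for some such state
  (`exists_re_expect_eq_dWaveSourceEnergyDensity`) and for every torus limit of ground-state vectors
  (`IsTorusLimitOf.re_expect_dWaveSourceEnergyObs_eq`) — Bratteli–Kishimoto–Robinson's mean-energy
  minimum for the sourced model.
* §4 CERTIFIED FINITE-VOLUME BOUNDS PASS TO THE LIMIT: `lo·L² ≤ E₀(A_L)` for all large `L` (the output
  shape of `dWaveSourceTorus_groundEnergy_ge_of_window_certificate_eventually`) gives `lo ≤ e_src`;
  `E₀(A_L) ≤ hi·L²` for all large `L` gives `e_src ≤ hi`; subsequence forms.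

Everything is PROVED; no definition (the three objects are defined in `DWaveSourceEnergyDensity.lean`), no named fact.
With `tendsto_dWaveSourceEnergyDensity` the CONDITIONAL Griffiths/cusp dictionary of
`DWaveSourceEnergyDensityLimit.lean` (hypothesis `hg : E_{L+1}(h)/(L+1)² → g(h)`) becomes unconditional with
`g := dWaveSourceEnergyDensity U μ` (spelled out in `DWaveSourceEnergyDensityTransport.lean`). HONEST SCOPE:
`t' = 0`, hopping `t = 1` (the tree's sourced torus); nothing here bears on whether the Hubbard model has
`d`-wave order — these are the plumbing theorems that make "certified window on `e_src(h)`" a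
well-defined sentence.

## References
* T. Koma, H. Tasaki, J. Stat. Phys. 76 (1994) 745, §1 (order parameters from the sourced Hamiltonian
  `H_Λ − hO_Λ` on periodic boxes, volume limit first). [cite: KomaTasaki1994, §1]
* O. Bratteli, A. Kishimoto, D. W. Robinson, CMP 64 (1978) 41, Thm. 2 (translation-invariant ground
  states minimise the mean energy). [cite: BratteliKishimotoRobinson1978, Thm. 2]
* O. Bratteli, D. W. Robinson, *OAQSM 2* (1997), §6.2.2 (periodic boundary conditions), §6.2.4 (mean
  energy). [cite: BratteliRobinsonII1997, §6.2.2]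
* D. Ruelle, *Statistical Mechanics* (1969), §3.3 (ground-state energy density as a limit).
  [cite: Ruelle1969, §3.3]
-/

noncomputable section

namespace Literature.MathematicalPhysics.QuantumLattice

open _root_.Matrix Finset HubbardWave0 Literature.Probability.LatticeModels _root_.Filter
open scoped _root_.Topology ComplexOrder BigOperators

/-! ### §1 The local energy-density observable of the sourced model -/

/-- `thicken {0} 1 ⊆ dWaveSourceWindow` (the Hubbard part of the sourced local objective lives in the unit
cube). [cite: KomaTasaki1994, §1] -/
theorem thicken_subset_dWaveSourceWindow : thicken ({0} : Finset (Site 2)) 1 ⊆ dWaveSourceWindow :=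
  Finset.subset_union_left

/-- `pairRegion {0,±e₁,±e₂} 0 ⊆ dWaveSourceWindow` (the pair-source part of the sourced local objective).
[cite: KomaTasaki1994, §1] -/
theorem pairRegion_subset_dWaveSourceWindow :
    pairRegion (insert (0 : Site 2) unitSteps) 0 ⊆ dWaveSourceWindow :=
  Finset.subset_union_right

/-- `0 ∈ dWaveSourceWindow` (the chemical-potential part of the sourced local objective sits at the origin).
[cite: KomaTasaki1994, §1] -/
theorem zero_mem_dWaveSourceWindow : (0 : Site 2) ∈ dWaveSourceWindow :=
  thicken_subset_dWaveSourceWindow (subset_thicken _ _ (Finset.mem_singleton_self _))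

/-- The mean-energy observable of a Hermitian interaction is Hermitian. [cite: BratteliKishimotoRobinson1978, §3 (mean energy functional)] -/
theorem FermionInteraction.meanEnergyObs_isHermitian {d : ℕ} {Ψ : FermionInteraction d}
    (hΨ : Ψ.IsHermitian) (R : ℝ) : (Ψ.meanEnergyObs R).IsHermitian := by
  unfold FermionInteraction.meanEnergyObs Matrix.IsHermitian
  rw [Matrix.conjTranspose_sum]
  refine Finset.sum_congr rfl fun X _ => ?_
  rw [Matrix.conjTranspose_smul, ← fermionEmbed_conjTranspose, (hΨ X.1).eq]
  congr 1
  rw [Complex.star_def, map_inv₀, map_natCast]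

/-- **`E^src` is Hermitian** (real `U, μ, h`). [cite: KomaTasaki1994, §1] -/
theorem dWaveSourceEnergyObs_isHermitian (U μ h : ℝ) : (dWaveSourceEnergyObs U μ h).IsHermitian := by
  unfold dWaveSourceEnergyObs
  have h1 : (fermionEmbed (PolySite.incl thicken_subset_dWaveSourceWindow)
      ((hubbardFermionInteraction 2 1 U).meanEnergyObs 1)).IsHermitian := by
    rw [Matrix.IsHermitian, ← fermionEmbed_conjTranspose,
      (FermionInteraction.meanEnergyObs_isHermitian (hubbardFermionInteraction_isHermitian 1 U) 1).eq]
  have h2 : ((μ : ℂ) • ∑ σ : Fin 2, nAt 0 zero_mem_dWaveSourceWindow σ :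
      FermionOp dWaveSourceWindow).IsHermitian := by
    refine IsHermitian.smul ?_ (by rw [isSelfAdjoint_iff, Complex.star_def, Complex.conj_ofReal])
    rw [Matrix.IsHermitian, Matrix.conjTranspose_sum]
    refine Finset.sum_congr rfl fun σ _ => ?_
    rw [nAt, ← numberAt_orb, (numberAt_isHermitian _).eq]
  have h3 : ((h : ℂ) • (fermionEmbed (PolySite.incl pairRegion_subset_dWaveSourceWindow)
        (localPairAt (insert (0 : Site 2) unitSteps) dWaveFormFactor 0) +
      (fermionEmbed (PolySite.incl pairRegion_subset_dWaveSourceWindow)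
        (localPairAt (insert (0 : Site 2) unitSteps) dWaveFormFactor 0))ᴴ) :
      FermionOp dWaveSourceWindow).IsHermitian := by
    refine IsHermitian.smul ?_ (by rw [isSelfAdjoint_iff, Complex.star_def, Complex.conj_ofReal])
    exact Matrix.isHermitian_add_transpose_self _
  exact (h1.sub h2).sub h3

/-- **Periodisation identity** (`L ≥ 3`): the torus translates of `Γ(E^src)` sum to the sourced torus
Hamiltonian, `Σ_{v ∈ (ℤ/Lℤ)²} T_v Γ(E^src) T_v⁻¹ = A_L(U,μ,h)` — the tree's
`sum_conj_fockTranslate_pairSourceObjective` (`T_v X T_v⁻¹ = U_v X U_vᴴ`). [cite: BratteliRobinsonII1997, §6.2.4] -/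
theorem sum_relabel_translate_dWaveSourceEnergyObs {L : ℕ} [NeZero L] (hL : 3 ≤ L)
    (hInj : Set.InjOn (Torus.proj (d := 2) L) ↑dWaveSourceWindow) (U μ h : ℝ) :
    ∑ v : TorusSite 2 L, relabel (Orb.translate v)
        (fermionEmbed (PolySite.toTorusEmb L hInj) (dWaveSourceEnergyObs U μ h)) =
      dWaveSourceTorus L U μ h := by
  have key := sum_conj_fockTranslate_pairSourceObjective dWaveFormFactor L thicken_subset_dWaveSourceWindow
    zero_mem_dWaveSourceWindow pairRegion_subset_dWaveSourceWindow hInj hL U μ h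
  rw [← dWaveSourceTorus_eq L U μ h] at key
  rw [← key]
  refine Finset.sum_congr rfl fun v _ => ?_
  rw [relabel_eq_fockRelabel_conj]
  rfl

/-- The periodisation identity along the sides `L + 1 ≥ 3`, in the hypothesis shape of
`exists_tendsto_groundEnergy_div_pow`. [cite: BratteliRobinsonII1997, §6.2.4] -/
theorem sum_relabel_translate_dWaveSourceEnergyObs_succ (U μ h : ℝ) :
    ∀ L : ℕ, 2 ≤ L → ∀ hInj : Set.InjOn (Torus.proj (d := 2) (L + 1)) ↑dWaveSourceWindow,
      ∑ v : TorusSite 2 (L + 1), relabel (Orb.translate v)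
          (fermionEmbed (PolySite.toTorusEmb (L + 1) hInj) (dWaveSourceEnergyObs U μ h)) =
        dWaveSourceTorus (L + 1) U μ h :=
  fun _ hL hInj => sum_relabel_translate_dWaveSourceEnergyObs (by omega) hInj U μ h

/-! ### §2 The thermodynamic limit exists -/

/-- The model-free limit theorem instantiated: limit, minimality over translation-invariant states,
attainment. [cite: BratteliKishimotoRobinson1978, Thm. 2] -/
theorem exists_tendsto_groundEnergy_dWaveSourceTorus_div_sq (U μ h : ℝ) :
    ∃ e : ℝ, Tendsto (fun L : ℕ => (dWaveSourceTorus (L + 1) U μ h).groundEnergy / (((L + 1 : ℕ) : ℝ)) ^ 2)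
        atTop (𝓝 e) ∧
      (∀ ω : InfVolFermionState 2, ω.IsTranslationInvariant →
        e ≤ (ω.expect dWaveSourceWindow (dWaveSourceEnergyObs U μ h)).re) ∧
      ∃ ω : InfVolFermionState 2, ω.IsTranslationInvariant ∧
        (ω.expect dWaveSourceWindow (dWaveSourceEnergyObs U μ h)).re = e :=
  exists_tendsto_groundEnergy_div_pow (d := 2) (dWaveSourceEnergyObs_isHermitian U μ h)
    (H := fun L => dWaveSourceTorus (L + 1) U μ h) (sum_relabel_translate_dWaveSourceEnergyObs_succ U μ h)

/-- **THE LIMIT EXISTS**: `E₀(A_{L+1}(U,μ,h))/(L+1)² → e_src(U,μ,h)` for all real `U, μ, h` — discharging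
the convergence hypothesis of the sourced Hellmann–Feynman bracket in thermodynamic-limit form
(`Summit.Ventures.CertifiedManyBodySolver.Observables.SourcedOrderParameterFloor` §3).
[cite: Ruelle1969, §3.3] -/
theorem tendsto_dWaveSourceEnergyDensity (U μ h : ℝ) :
    Tendsto (fun L : ℕ => (dWaveSourceTorus (L + 1) U μ h).groundEnergy / (((L + 1 : ℕ) : ℝ)) ^ 2)
      atTop (𝓝 (dWaveSourceEnergyDensity U μ h)) := by
  obtain ⟨e, he, -, -⟩ := exists_tendsto_groundEnergy_dWaveSourceTorus_div_sq U μ h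
  exact tendsto_nhds_limUnder ⟨e, he⟩

/-! ### §3 Variational characterisation -/

/-- **Variational principle (every translation-invariant state is above `e_src`)**:
`e_src(U,μ,h) ≤ Re ω(E^src(U,μ,h))` for every translation-invariant infinite-volume state `ω` of the
lattice fermions on `ℤ²`. [cite: BratteliKishimotoRobinson1978, Thm. 2] -/
theorem dWaveSourceEnergyDensity_le_re_expect (U μ h : ℝ) (ω : InfVolFermionState 2)
    (hω : ω.IsTranslationInvariant) :
    dWaveSourceEnergyDensity U μ h ≤ (ω.expect dWaveSourceWindow (dWaveSourceEnergyObs U μ h)).re := by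
  obtain ⟨e, he, hle, -⟩ := exists_tendsto_groundEnergy_dWaveSourceTorus_div_sq U μ h
  rw [tendsto_nhds_unique (tendsto_dWaveSourceEnergyDensity U μ h) he]
  exact hle ω hω

/-- **The minimum is attained**: some translation-invariant state has `Re ω(E^src) = e_src`
(a torus limit of ground-state vectors). [cite: BratteliKishimotoRobinson1978, Thm. 2] -/
theorem exists_re_expect_eq_dWaveSourceEnergyDensity (U μ h : ℝ) :
    ∃ ω : InfVolFermionState 2, ω.IsTranslationInvariant ∧
      (ω.expect dWaveSourceWindow (dWaveSourceEnergyObs U μ h)).re = dWaveSourceEnergyDensity U μ h := by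
  obtain ⟨e, he, -, ω, hω, hωe⟩ := exists_tendsto_groundEnergy_dWaveSourceTorus_div_sq U μ h
  exact ⟨ω, hω, hωe.trans (tendsto_nhds_unique he (tendsto_dWaveSourceEnergyDensity U μ h))⟩

/-- **Torus limits of sourced ground states carry `e_src`.** If `ψ L` is, for every side `L ≥ 1`, a unit
ground-state vector of `A_L(U,μ,h)` and `ω` is a torus limit of `ψ` along `Ls → ∞`, then
`Re ω(E^src(U,μ,h)) = e_src(U,μ,h)`. [cite: BratteliRobinsonII1997, §6.2.4] -/
theorem InfVolFermionState.IsTorusLimitOf.re_expect_dWaveSourceEnergyObs_eq (U μ h : ℝ)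
    {ψ : ∀ L, Fock (Orb (FermionTorus 2 L))}
    (h1 : ∀ (L : ℕ) [NeZero L], star (ψ L) ⬝ᵥ ψ L = 1)
    (hψ : ∀ (L : ℕ) [NeZero L],
      dWaveSourceTorus L U μ h *ᵥ ψ L = (((dWaveSourceTorus L U μ h).groundEnergy : ℝ) : ℂ) • ψ L)
    {Ls : ℕ → ℕ} (hLs : Tendsto Ls atTop atTop) {ω : InfVolFermionState 2} (hω : ω.IsTorusLimitOf ψ Ls) :
    (ω.expect dWaveSourceWindow (dWaveSourceEnergyObs U μ h)).re = dWaveSourceEnergyDensity U μ h := by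
  set F : ℕ → ℝ := fun n =>
    (torusAvgExpect n dWaveSourceWindow (dWaveSourceEnergyObs U μ h) (ψ n)).re with hF
  set G : ℕ → ℝ := fun K =>
    (dWaveSourceTorus (K + 1) U μ h).groundEnergy / (((K + 1 : ℕ) : ℝ)) ^ 2 with hG
  -- the averaged expectations of `E^src` are the energies per site (for all large sides)
  have hev : ∀ᶠ K : ℕ in atTop, F (K + 1) = G K :=
    re_torusAvgExpect_eq_groundEnergy_div_of_groundState (d := 2) (L₀ := 2)
      (H := fun L => dWaveSourceTorus (L + 1) U μ h) (sum_relabel_translate_dWaveSourceEnergyObs_succ U μ h)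
      (ψ := ψ) (fun K _ => h1 (K + 1)) (fun K _ => hψ (K + 1))
  have hlim : Tendsto (fun j => F (Ls j)) atTop
      (𝓝 (ω.expect dWaveSourceWindow (dWaveSourceEnergyObs U μ h)).re) :=
    (Complex.continuous_re.tendsto _).comp (hω dWaveSourceWindow (dWaveSourceEnergyObs U μ h))
  -- along `Ls`: `F (Ls j) = G (Ls j − 1)` eventually, and `G (Ls j − 1) → e_src`
  have hK : Tendsto (fun j => Ls j - 1) atTop atTop := (tendsto_sub_atTop_nat 1).comp hLs
  have hconv : Tendsto (fun j => G (Ls j - 1)) atTop (𝓝 (dWaveSourceEnergyDensity U μ h)) :=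
    (tendsto_dWaveSourceEnergyDensity U μ h).comp hK
  refine tendsto_nhds_unique hlim (hconv.congr' ?_)
  filter_upwards [hK.eventually hev, hLs.eventually_ge_atTop 1] with j hj hj1
  -- hj : F (Ls j - 1 + 1) = G (Ls j - 1)
  rw [← hj, Nat.sub_add_cancel hj1]

/-! ### §4 Certified finite-volume bounds pass to the limit -/

/-- **Certified lower bounds pass to the limit** (the output shape of
`dWaveSourceTorus_groundEnergy_ge_of_window_certificate_eventually`): if `lo · L² ≤ E₀(A_L)` for all
`L ≥ L₀`, then `lo ≤ e_src(U,μ,h)`. [cite: Ruelle1969, §3.3] -/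
theorem dWaveSourceEnergyDensity_ge_of_forall_le (U μ h : ℝ) {lo : ℝ} {L₀ : ℕ}
    (hlo : ∀ (L : ℕ) [NeZero L], L₀ ≤ L → lo * (L : ℝ) ^ 2 ≤ (dWaveSourceTorus L U μ h).groundEnergy) :
    lo ≤ dWaveSourceEnergyDensity U μ h := by
  refine ge_of_tendsto (tendsto_dWaveSourceEnergyDensity U μ h) ?_
  filter_upwards [eventually_ge_atTop L₀] with L hL
  have hpos : (0 : ℝ) < (((L + 1 : ℕ) : ℝ)) ^ 2 := by positivity
  rw [le_div_iff₀ hpos]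
  exact hlo (L + 1) (by omega)

/-- **Certified upper bounds pass to the limit**: if `E₀(A_L) ≤ hi · L²` for all `L ≥ L₀` (e.g. Rayleigh
quotients of trial states on every large torus), then `e_src(U,μ,h) ≤ hi`. [cite: Ruelle1969, §3.3] -/
theorem dWaveSourceEnergyDensity_le_of_forall_le (U μ h : ℝ) {hi : ℝ} {L₀ : ℕ}
    (hhi : ∀ (L : ℕ) [NeZero L], L₀ ≤ L → (dWaveSourceTorus L U μ h).groundEnergy ≤ hi * (L : ℝ) ^ 2) :
    dWaveSourceEnergyDensity U μ h ≤ hi := by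
  refine le_of_tendsto (tendsto_dWaveSourceEnergyDensity U μ h) ?_
  filter_upwards [eventually_ge_atTop L₀] with L hL
  have hpos : (0 : ℝ) < (((L + 1 : ℕ) : ℝ)) ^ 2 := by positivity
  rw [div_le_iff₀ hpos]
  exact hhi (L + 1) (by omega)

/-- `∀ᶠ`-form of the lower passage (sides `L + 1`). [cite: Ruelle1969, §3.3] -/
theorem dWaveSourceEnergyDensity_ge_of_eventually_le (U μ h : ℝ) {lo : ℝ}
    (hlo : ∀ᶠ L : ℕ in atTop, lo * (((L + 1 : ℕ) : ℝ)) ^ 2 ≤ (dWaveSourceTorus (L + 1) U μ h).groundEnergy) :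
    lo ≤ dWaveSourceEnergyDensity U μ h := by
  refine ge_of_tendsto (tendsto_dWaveSourceEnergyDensity U μ h) ?_
  filter_upwards [hlo] with L hL
  have hpos : (0 : ℝ) < (((L + 1 : ℕ) : ℝ)) ^ 2 := by positivity
  rwa [le_div_iff₀ hpos]

/-- `∀ᶠ`-form of the upper passage (sides `L + 1`). [cite: Ruelle1969, §3.3] -/
theorem dWaveSourceEnergyDensity_le_of_eventually_le (U μ h : ℝ) {hi : ℝ}
    (hhi : ∀ᶠ L : ℕ in atTop, (dWaveSourceTorus (L + 1) U μ h).groundEnergy ≤ hi * (((L + 1 : ℕ) : ℝ)) ^ 2) :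
    dWaveSourceEnergyDensity U μ h ≤ hi := by
  refine le_of_tendsto (tendsto_dWaveSourceEnergyDensity U μ h) ?_
  filter_upwards [hhi] with L hL
  have hpos : (0 : ℝ) < (((L + 1 : ℕ) : ℝ)) ^ 2 := by positivity
  rwa [div_le_iff₀ hpos]

end Literature.MathematicalPhysics.QuantumLattice

end
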